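import Summits.QuantumFields.YangMills.Theorems.BalabanUVNodesN15AtReadingOfRecord13CoPHByParts
import Summits.QuantumFields.YangMills.Theorems.BalabanUVNodesN15BackgroundByPartsPrimitive

/-!
# Route «BalabanUVNodes», cluster K4 «SpineRates» — node N15 = NE2: `N15At` WITH THE OPERATOR LAYER's BACKGROUND BLOCK LIVE OVER THE PRIMITIVE (3.35)–(3.36) CARRIER —
# dag-n15-c's FILE-11 family (`ne2PlusOperator_fullG_C2`: Bałaban's full `U ≡ 1` propagator dressed by a first-order scalar background whose regularity is ONLY the sup
# letters on `U`, `∇′U`, `∇′∇′U`) THROUGH THE GENERIC KNIT (part 78), its `NE2Objects₁₁` literal, keyed-home faces AND the Stage-13 v1.7 `CoPH` producer faces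
# (dag-n15-c g8 LANDED-9∕12∕13 + FILED-11∕14, INBOX l.22517: «→ dag-n15-a successor: THIS is the background-LIVE operator family for an `NE2Objects₁₁`∕`N15At` literal»)

Cell `pub-ymgap`, seat `pub-ymgap-dag-n15-a` (-a KNIT-BY-NAME seat of node N15; HUMAN RULING D-0062; chair R424 venue), generation 16, part 81 (ONE data `def` — the
`NE2Objects₁₁` literal `c2Objects` —, the rest theorems; 0 `sorry`).  `bears_on: R4∕N15 · K3⁷ SpineGivenEndpointR13SepCoPH (stmt-QuantumFields-20544; dag-lead WORDS-143)`.
Filed `--kind proof --supports stmt-QuantumFields-20544 --as helper` — COUNT-NEUTRAL.  Imports this seat's part 80 `…N15AtReadingOfRecord13CoPHByParts` (brings part 79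
`FGIndexL`, `fgIndexL_nonempty`; part 78 `tgSiteOn`, `tgCovOn`, ★★★ `n15At_tg_of_ne2PlusOperator`; part 75 the `CoPH` home faces) and dag-n15-c FILE 11
`…N15BackgroundByPartsPrimitive` (p560289 ✓: `coeffBgC2`, `fgInstanceC2`, `fgFamilyC2`, ★★★ `ne2PlusOperator_fullG_C2`); nothing in the tree is modified; no name re-declared.

WHAT.  Part 79 ∕ 80 VERBATIM for the PRIMITIVE carrier.  dag-n15-c's realised instances `fgInstanceC2 d hL i` ARE `⟨tgGeoC d hL i.1, fineGeo …, coeffBgC2 …, coeffBgC2 …,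
bgPairingC2 …⟩` (FILE 11 `bgInstanceC2`), so part 78 applies with `ι = Prod.fst ∘ val`, the fine geometry ∕ background carriers ∕ pairing read off the instance, and
`Kop := fgFamilyC2 d hL b`; NO rate exponent among the data (FILE 11 PRODUCES `1∕(8(d+1))` inside the `∃`):
* §1 ★★★ **`n15At_fullG_C2`**: for `d ≥ 1`, odd `L ≥ 3`, `b, a_S > 0`, `c₃₅ > 0`, directions `α β`, every `p`:
  `N15At ⟨FGIndexL d, c₃₅, p, fgInstanceC2 ∘ val, fgFamilyC2 b ∘ val, tgSiteOn a_S (fst ∘ val) (Bf ∘ …), tgCovOn α β (fst ∘ val) (Bf ∘ …), ⊤, dist⟩` — OPERATOR = FILE 11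
  (background block LIVE: the regularity consumed is exactly `|U|, |∇′U|, |∇′∇′U| ≤ c₃₅Mα₀`), re-indexed by `NE2NodeTorus.ne2PlusOperator_reindex val`; SITE ∕ UNIT = the two
  `U ≡ 1` kernels (G1's `(Q′G′²Q′*)⁻¹`, [B6] (2.156) `C^{(k)}_Λ`), blind to the background — their «+» idle, said; NO displayed binder, NO weight window;
* §2 def `c2Objects d hL b a_S α β c₃₅ p : Node00.NE2Objects₁₁`, `ne2OfRecord₁₁_c2Objects` (rfl), `n15At_c2Objects` (`c₃₅ > 0`), `populated_c2Objects`;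
* §3 keyed-home faces (part 30's interface): `s_N15_of_admits_C2`, ★★ `s_N15_of_admits_C2_family` (`fgInstanceC2 3 F.hL`, block factor `F.L`), `populated_c2Objects_family`,
  `n15At_c2Objects_family`;
* §4 the v1.7 `CoPH` producer faces (part 80's, for THIS family): `s_N15_rRec₁₃CoPH_of_c2Reading`, `s_N15_rRec₁₃CoPHOn_of_c2Reading`,
  ★★ `exists_reading_s_N15_rRec₁₃CoPH_c2_family`, ★★ `s_N15_readingOfRecord₁₃CoPH_homes_of_c2_family` (the shape n27-c's leaves consume, conclusion both homes),
  `s_N15_readingOfRecord₁₃CoPH_of_c2_family`, `s_N15_readingOfRecord₁₃CoPHOn_of_c2_family`, `populated_readingOfRecord₁₃CoPH_of_c2_family`; the family-free existence face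
  «some residual layer closes `h15` at both homes» is part 80's `exists_ne2_s_N15_readingOfRecord₁₃CoPH_byParts` VERBATIM (same statement, this family another witness) —
  cited, not re-filed.

HONEST FRAMING.  Count-neutral kernel composition BY NAME; no new estimate (FILE 11 ⇐ FILES 9∕10 ⇐ FILE 8; G1; `T4Cov2156Rate`).  WHAT THE FAMILY IS: operator layer =
Bałaban's full `U ≡ 1` Landau-gauge propagator `G = Δ_b⁻¹` dressed by a LIVE first-order SCALAR background whose admitted class is cut out by the PRIMITIVE sup letters (the
(3.35)–(3.36) SHAPE, one uniform constant `c₃₅Mα₀`, no scale-dependent gains) — dag-n15-c's species: abelianised coefficients (`V′₁` of (3.52) as scalar multiplications, forward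
orientation), block-averaged coarse partner (convention (C3)) — MODEL-LEVEL in the background, GENUINE in the propagator; NOT Bałaban's non-abelian `V′(A)` of (3.52)∕(3.60);
site ∕ unit layers = the `U ≡ 1` objects, which do not see the background; [B9] size parameter `gf.M` = the unit-torus carrier's; rates sup-block-currency artefacts.  WHAT IT
IS NOT: NOT [B9] Thms 3.1∕3.2∕3.15 at a general (3.35)-regular `U` (NE2⁺ proper — NOT PRINTED as η-rates), NOT Node 00's [B9] operator layer of record (residual) — **N15 is
NOT discharged** (typed 28∕28 · discharged 5∕27 of record unchanged); the readings `𝔯`, towers `w1`, letters `ℓ₃`, NODE O's `ne1` of §4 are PARAMETERS; one finite four-torus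
programme at fixed `ε` — NOT ℝ⁴, NOT infinite volume, NOT OS, NOT a mass gap, NOT Clay.  Restate-immune (no Theses import).
-/

set_option autoImplicit false

noncomputable section
namespace Summit.QuantumFields.YangMills.BalabanUVNodes.N15.GenuineRecord

open Literature.MathematicalPhysics.QuantumFieldTheory.Balaban1983to89
open Literature.MathematicalPhysics.QuantumFieldTheory.Balaban1983to89.T4Continuum (T4Family ULoop)
open Literature.MathematicalPhysics.QuantumFieldTheory.Balaban1983to89.T4EtaRate (PairedInstance NE2PlusOperator NE2PlusSite NE2PlusUnit)
open Literature.MathematicalPhysics.QuantumFieldTheory.Balaban1983to89.NE2NodeTorus (ne2PlusOperator_reindex)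
open Node00 (NE2Objects₁₁)
open Summit.QuantumFields.BalabanUV.T4Continuum.HistoryFlow (two_le_L)
open Summit.QuantumFields.YangMills.BalabanUVNodes.N15.TwoGrid (TGIndex tgGeoC)
open Summit.QuantumFields.YangMills.BalabanUVNodes.N15.BackgroundLayer (fgInstanceC2 fgFamilyC2 ne2PlusOperator_fullG_C2)
open Summit.QuantumFields.YangMills.BalabanUVNodes.N15.AtKeyedHome (s_N15_of_admits neZero_blockFactor)
open YMDAG.UVSplit (Datum NE2Carriers RateCarriers RateRecordPred N15At S_N15 ne2OfRecord₁₁)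

variable {d : ℕ} {L : ℕ} [NeZero L]

/-! ## §1 `N15At` for FILE 11's family over the primitive carrier (index = part 79's `FGIndexL d` by name) -/

/-- ★★★ **`N15At` — ALL THREE CONJUNCTS BY NAME, NO DISPLAYED BINDER — FOR dag-n15-c's PRIMITIVE-CARRIER FAMILY: Bałaban's full `U ≡ 1` Landau-gauge propagator DRESSED BY
A LIVE FIRST-ORDER SCALAR BACKGROUND whose regularity is ONLY the sup letters `|U|, |∇′U|, |∇′∇′U| ≤ c₃₅Mα₀` in the operator layer; the genuine site kernel and the (2.156)
covariance (blind to the background) in the other two.**  For `d ≥ 1`, odd `L ≥ 3`, `b, a_S > 0`, `c₃₅ > 0`, directions `α β`, every `p` — ONE application of part 78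
`n15At_tg_of_ne2PlusOperator` to FILE 11's `ne2PlusOperator_fullG_C2` (re-indexed to the L-divisible sub-index); NO rate exponent among the data. [bookkeeping] -/
theorem n15At_fullG_C2 (hd : 1 ≤ d) (hLodd : Odd L) (hL2 : 2 ≤ L) (hL : Odd L ∧ 1 < L) {b aS : ℝ} (hb : 0 < b) (haS : 0 < aS) {c35 : ℝ} (hc35 : 0 < c35)
    (α β : Fin (d + 1)) (p : ℝ) :
    N15At { I := FGIndexL d, c35 := c35, p := p, pi := fun i => fgInstanceC2 d hL i.1,
            Kop := fun i => fgFamilyC2 d hL b i.1,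
            Ksite := tgSiteOn d hL aS (fun i : FGIndexL d => i.1.1) (fun i => (fgInstanceC2 d hL i.1).Bf),
            Kunit := tgCovOn d hL α β (fun i : FGIndexL d => i.1.1) (fun i => (fgInstanceC2 d hL i.1).Bf),
            inΛ := fun _ _ => True, unitDist := fun i => (tgGeoC d hL i.1.1).dist } :=
  n15At_tg_of_ne2PlusOperator (d := d) (fun i : FGIndexL d => i.1.1) (fun i => (fgInstanceC2 d hL i.1).gf)
    (fun i => (fgInstanceC2 d hL i.1).Bc) (fun i => (fgInstanceC2 d hL i.1).Bf)
    hd hLodd hL2 hL haS α β (fun i => i.2) (fun i => (fgInstanceC2 d hL i.1).pair) p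
    (fun i => fgFamilyC2 d hL b i.1)
    (ne2PlusOperator_reindex (Subtype.val : FGIndexL d → TGIndex × Fin (d + 1)) (ne2PlusOperator_fullG_C2 d hd hLodd hL2 hL hb c35 hc35))

/-! ## §2 The primitive-carrier family as N15's `NE2Objects₁₁` literal -/

/-- **N15's NE2 OBJECTS OF THE PRIMITIVE-CARRIER FAMILY** (RR-1's layer-A container): index `FGIndexL d`, letters `c₃₅`, `p`, dag-n15-c's realised instances `fgInstanceC2 d hL`
(coarse∕fine unit-torus carriers, King's pairing, coefficient backgrounds `coeffBgC2` with the PRIMITIVE (3.35)–(3.36) letters — sup bounds on the field, its first and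
second difference quotients; NO rate number), OPERATOR kernels `fgFamilyC2 b` (full `U ≡ 1` propagator dressed by the live first-order scalar background, all four (3.42)
entries, entry 2 by parts), SITE `tgSiteOn a_S` (G1's kernel), UNIT `tgCovOn α β` ((2.156)), region `⊤`, unit distance = the carrier's. [bookkeeping] -/
def c2Objects (d : ℕ) (hL : Odd L ∧ 1 < L) (b aS : ℝ) (α β : Fin (d + 1)) (c35 p : ℝ) : NE2Objects₁₁ where
  I := FGIndexL d
  c35 := c35
  p := p
  pi := fun i => fgInstanceC2 d hL i.1
  Kop := fun i => fgFamilyC2 d hL b i.1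
  Ksite := tgSiteOn d hL aS (fun i : FGIndexL d => i.1.1) (fun i => (fgInstanceC2 d hL i.1).Bf)
  Kunit := tgCovOn d hL α β (fun i : FGIndexL d => i.1.1) (fun i => (fgInstanceC2 d hL i.1).Bf)
  inΛ := fun _ _ => True
  unitDist := fun i => (tgGeoC d hL i.1.1).dist

/-- The home's NE2 bundle of the primitive-carrier objects IS §1's record (`rfl`). [bookkeeping] -/
theorem ne2OfRecord₁₁_c2Objects (hL : Odd L ∧ 1 < L) (b aS : ℝ) (α β : Fin (d + 1)) (c35 p : ℝ) :
    ne2OfRecord₁₁ (c2Objects d hL b aS α β c35 p) =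
      { I := FGIndexL d, c35 := c35, p := p, pi := fun i => fgInstanceC2 d hL i.1,
        Kop := fun i => fgFamilyC2 d hL b i.1,
        Ksite := tgSiteOn d hL aS (fun i : FGIndexL d => i.1.1) (fun i => (fgInstanceC2 d hL i.1).Bf),
        Kunit := tgCovOn d hL α β (fun i : FGIndexL d => i.1.1) (fun i => (fgInstanceC2 d hL i.1).Bf),
        inΛ := fun _ _ => True, unitDist := fun i => (tgGeoC d hL i.1.1).dist } := rfl

/-- ★★★ **`N15At` AT THE PRIMITIVE-CARRIER OBJECTS' BUNDLE** (`c₃₅ > 0`; §1 read through `ne2OfRecord₁₁`). [bookkeeping] -/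
theorem n15At_c2Objects (hd : 1 ≤ d) (hLodd : Odd L) (hL2 : 2 ≤ L) (hL : Odd L ∧ 1 < L) {b aS : ℝ} (hb : 0 < b) (haS : 0 < aS) {c35 : ℝ} (hc35 : 0 < c35)
    (α β : Fin (d + 1)) (p : ℝ) : N15At (ne2OfRecord₁₁ (c2Objects d hL b aS α β c35 p)) :=
  n15At_fullG_C2 (d := d) hd hLodd hL2 hL hb haS hc35 α β p

/-- **RR-1's DISPLAY HOLDS AT THE PRIMITIVE-CARRIER LITERAL**: `Populated`. [bookkeeping] -/
theorem populated_c2Objects (hL : Odd L ∧ 1 < L) (b aS : ℝ) (α β : Fin (d + 1)) (c35 p : ℝ) :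
    (c2Objects d hL b aS α β c35 p).Populated :=
  (NE2Objects₁₁.populated_iff _).2 fgIndexL_nonempty

/-! ## §3 The keyed-home faces: a home admitting the primitive-carrier literals has `S_N15`, no estimate displayed -/

section KeyedHome

variable {N : ℕ} [NeZero N] {key : (F : T4Family) → Datum F N → Prop}

/-- ★★ **THE PRIMITIVE-CARRIER READING CLOSES THE STUB AT ANY KEYED HOME** (part 30's interface): `d ≥ 1`, odd `L ≥ 3`, `b, a_S > 0`, `c₃₅ > 0`, `α β`, `p`: a rate home
`RRec` over ANY key admitting only the literals of a key-indexed NE2 reading valued in `c2Objects d hL b a_S α β c₃₅ p` has `S_N15 RRec` — the estimate is §1 (operator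
layer with the background block LIVE over the primitive letters), not a hypothesis. [bookkeeping] -/
theorem s_N15_of_admits_C2 (hd : 1 ≤ d) (hLodd : Odd L) (hL2 : 2 ≤ L) (hL : Odd L ∧ 1 < L) {b aS : ℝ} (hb : 0 < b) (haS : 0 < aS) {c35 : ℝ} (hc35 : 0 < c35)
    (α β : Fin (d + 1)) (p : ℝ)
    (ne2At : ∀ {F : T4Family} {D : Datum F N}, key F D → (ℕ → ℝ) → List (ULoop F) → ℕ → NE2Objects₁₁) (RRec : RateRecordPred N)
    (hadm : ∀ (F : T4Family) (D : Datum F N) (g₀ : ℕ → ℝ) (os : List (ULoop F)) (R : RateCarriers N), RRec F D g₀ os R →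
      ∃ (h : key F D) (k : ℕ), R.ne2 = ne2OfRecord₁₁ (ne2At h g₀ os k))
    (h : ∀ (F : T4Family) (D : Datum F N) (h : key F D) (g₀ : ℕ → ℝ) (os : List (ULoop F)) (k : ℕ), ne2At h g₀ os k = c2Objects d hL b aS α β c35 p) :
    S_N15 RRec := by
  refine s_N15_of_admits ne2At RRec hadm fun F D hk g₀ os k => ?_
  rw [h F D hk g₀ os k]
  exact n15At_c2Objects (d := d) hd hLodd hL2 hL hb haS hc35 α β p

/-- ★★ **THE FAMILY-KEYED PRIMITIVE-CARRIER READING CLOSES THE STUB AT ANY KEYED HOME** (`d + 1 = 4`; the reading reads the datum's family: `fgInstanceC2 3 F.hL`, block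
factor `F.L`). [bookkeeping] -/
theorem s_N15_of_admits_C2_family {b aS : ℝ} (hb : 0 < b) (haS : 0 < aS) {c35 : ℝ} (hc35 : 0 < c35) (α β : Fin 4) (p : ℝ)
    (ne2At : ∀ {F : T4Family} {D : Datum F N}, key F D → (ℕ → ℝ) → List (ULoop F) → ℕ → NE2Objects₁₁) (RRec : RateRecordPred N)
    (hadm : ∀ (F : T4Family) (D : Datum F N) (g₀ : ℕ → ℝ) (os : List (ULoop F)) (R : RateCarriers N), RRec F D g₀ os R →
      ∃ (h : key F D) (k : ℕ), R.ne2 = ne2OfRecord₁₁ (ne2At h g₀ os k))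
    (h : ∀ (F : T4Family) (D : Datum F N) (h : key F D) (g₀ : ℕ → ℝ) (os : List (ULoop F)) (k : ℕ),
      ne2At h g₀ os k = haveI := neZero_blockFactor F; c2Objects 3 F.hL b aS α β c35 p) :
    S_N15 RRec := by
  refine s_N15_of_admits ne2At RRec hadm fun F D hk g₀ os k => ?_
  rw [h F D hk g₀ os k]
  haveI := neZero_blockFactor F
  exact n15At_c2Objects (d := 3) (by norm_num) F.hL.1 (two_le_L F) F.hL hb haS hc35 α β p

/-- **RR-1's DISPLAY AT THE FAMILY-KEYED PRIMITIVE-CARRIER LITERAL**. [bookkeeping] -/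
theorem populated_c2Objects_family (F : T4Family) (b aS : ℝ) (α β : Fin 4) (c35 p : ℝ) :
    (haveI := neZero_blockFactor F; c2Objects 3 F.hL b aS α β c35 p).Populated := by
  haveI := neZero_blockFactor F
  exact populated_c2Objects F.hL b aS α β c35 p

/-- `N15At` at the primitive-carrier literal of a datum family (`(3, F.hL)`; `2 ≤ F.L` from `11 < L`; `c₃₅ > 0`). [bookkeeping] -/
theorem n15At_c2Objects_family {b aS : ℝ} (hb : 0 < b) (haS : 0 < aS) {c35 : ℝ} (hc35 : 0 < c35) (α β : Fin 4) (p : ℝ) (F : T4Family) :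
    N15At (ne2OfRecord₁₁ (haveI := neZero_blockFactor F; c2Objects 3 F.hL b aS α β c35 p)) := by
  haveI := neZero_blockFactor F
  exact n15At_c2Objects (d := 3) (by norm_num) F.hL.1 (two_le_L F) F.hL hb haS hc35 α β p

end KeyedHome

end Summit.QuantumFields.YangMills.BalabanUVNodes.N15.GenuineRecord

/-! ## §4 The primitive-carrier family at both Stage-13 v1.7 `CoPH` homes and at the reading of record (part 80's faces for THIS family) -/

namespace Summit.QuantumFields.YangMills.BalabanUVNodes.N15.AtReadingOfRecord13CoPH

open Literature.MathematicalPhysics.QuantumFieldTheory.Balaban1983to89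
open Literature.MathematicalPhysics.QuantumFieldTheory.Balaban1983to89.T4Continuum (T4Family ULoop)
open Node00 (IsDatumOfRecord₁₃CCoPH Stage13HParams NE2Objects₁₁ NE3Letters₁₁)
open Node00.W1 (ReadingData)
open Summit.QuantumFields.YangMills.BalabanUVNodes.N15.AtKeyedHome (neZero_blockFactor)
open Summit.QuantumFields.YangMills.BalabanUVNodes.N15.AtRRec13CoPH (admits_rRec₁₃CoPH_ne2 s_N15_rRec₁₃CoPHOn_of_pin s_N15_homes₁₃CoPH_of_forall_admissible)
open Summit.QuantumFields.YangMills.BalabanUVNodes.N15.GenuineRecord (c2Objects n15At_c2Objects_family s_N15_of_admits_C2_family populated_c2Objects_family)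
open YMDAG.UVSplit (Datum NE1pCarriers RateCarriers RateRecordPred N15At S_N15 ne2OfRecord₁₁ RateReading₁₃CoPH RRec₁₃CoPH RRec₁₃CoPHOn readingOfRecord₁₃CoPH
  readingOfRecord₁₃CoPH_populated_iff)

variable {N : ℕ} [NeZero N]

section C2

variable {b aS : ℝ}

/-- ★ **THE PRIMITIVE-CARRIER READING CLOSES THE STUB AT THE CANONICAL HOME, NO ESTIMATE DISPLAYED.**  For `b, a_S > 0`, `c₃₅ > 0`, directions `α β`, exponent `p`: a
reading `𝔯` whose NE2 objects at every Stage-13 datum key ARE `c2Objects 3 F.hL b a_S α β c₃₅ p` (operator layer: Bałaban's full `U ≡ 1` propagator dressed by dag-n15-c's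
live first-order scalar background over the primitive (3.35)–(3.36) letters; site: `(Q′G′²Q′*)⁻¹`; unit: the (2.156) covariance; on the family's OWN block factor) has
`S_N15 (RRec₁₃CoPH 𝔯)` — §3 `s_N15_of_admits_C2_family` at the certificate `admits_rRec₁₃CoPH_ne2`. [bookkeeping] -/
theorem s_N15_rRec₁₃CoPH_of_c2Reading (hb : 0 < b) (haS : 0 < aS) {c35 : ℝ} (hc35 : 0 < c35) (α β : Fin 4) (p : ℝ) (𝔯 : RateReading₁₃CoPH N)
    (h : ∀ (F : T4Family) (D : Datum F N) (hD : IsDatumOfRecord₁₃CCoPH F N D) (g₀ : ℕ → ℝ) (os : List (ULoop F)) (k : ℕ),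
      (𝔯.lit F hD.params hD.provisos g₀ os).ne2 k = haveI := neZero_blockFactor F; c2Objects 3 F.hL b aS α β c35 p) :
    S_N15 (RRec₁₃CoPH 𝔯) :=
  s_N15_of_admits_C2_family (N := N) (key := fun F D => IsDatumOfRecord₁₃CCoPH F N D) hb haS hc35 α β p
    (fun {F D} (hD : IsDatumOfRecord₁₃CCoPH F N D) g₀ os k => (𝔯.lit F hD.params hD.provisos g₀ os).ne2 k) (RRec₁₃CoPH 𝔯) (admits_rRec₁₃CoPH_ne2 𝔯) h

/-- ★ **THE PRIMITIVE-CARRIER READING CLOSES THE STUB AT EVERY GUARDED HOME** (θ-form on the admissible tuples with provisos in `Rg`; §3 at `(3, F.hL)` through 74b's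
`s_N15_rRec₁₃CoPHOn_of_pin`). [bookkeeping] -/
theorem s_N15_rRec₁₃CoPHOn_of_c2Reading (hb : 0 < b) (haS : 0 < aS) {c35 : ℝ} (hc35 : 0 < c35) (α β : Fin 4) (p : ℝ) (𝔯 : RateReading₁₃CoPH N)
    (Rg : (F : T4Family) → Stage13HParams F N → Prop)
    (h : ∀ (F : T4Family) (θ : Stage13HParams F N) (hP : θ.Provisos₁₃CoPH F N), Rg F θ → θ.Admissible F N → ∀ (g₀ : ℕ → ℝ) (os : List (ULoop F)) (k : ℕ),
      (𝔯.lit F θ hP g₀ os).ne2 k = haveI := neZero_blockFactor F; c2Objects 3 F.hL b aS α β c35 p) :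
    S_N15 (RRec₁₃CoPHOn 𝔯 Rg) :=
  s_N15_rRec₁₃CoPHOn_of_pin 𝔯 Rg (fun F _ _ _ _ _ => haveI := neZero_blockFactor F; c2Objects 3 F.hL b aS α β c35 p) h
    fun F _ _ _ _ _ _ _ => n15At_c2Objects_family hb haS hc35 α β p F

/-- ★★ **SOME READING CLOSES THE STUB AT BOTH CoPH HOMES OUTRIGHT ON THE PRIMITIVE-CARRIER OBJECTS, POPULATED EVERYWHERE** [decided, non-degenerate, operator «+» live over
the primitive letters]: for `b, a_S > 0`, `c₃₅ > 0`, `α β`, `p` there is a Stage-13 rate reading `𝔯` whose NE2 objects at every tuple ARE `c2Objects 3 F.hL b a_S α β c₃₅ p`,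
`Populated` everywhere (RR-1 §8), with `S_N15 (RRec₁₃CoPH 𝔯)` and `S_N15 (RRec₁₃CoPHOn 𝔯 Rg)` for every `Rg`, NO hypothesis. [bookkeeping] -/
theorem exists_reading_s_N15_rRec₁₃CoPH_c2_family (hb : 0 < b) (haS : 0 < aS) {c35 : ℝ} (hc35 : 0 < c35) (α β : Fin 4) (p : ℝ) :
    ∃ 𝔯 : RateReading₁₃CoPH N,
      (∀ (F : T4Family) (θ : Stage13HParams F N) (hP : θ.Provisos₁₃CoPH F N) (g₀ : ℕ → ℝ) (os : List (ULoop F)) (k : ℕ),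
        (𝔯.lit F θ hP g₀ os).ne2 k = haveI := neZero_blockFactor F; c2Objects 3 F.hL b aS α β c35 p) ∧
      (∀ (F : T4Family) (θ : Stage13HParams F N) (hP : θ.Provisos₁₃CoPH F N) (g₀ : ℕ → ℝ) (os : List (ULoop F)) (k : ℕ),
        ((𝔯.lit F θ hP g₀ os).ne2 k).Populated) ∧
      S_N15 (RRec₁₃CoPH 𝔯) ∧ ∀ Rg : (F : T4Family) → Stage13HParams F N → Prop, S_N15 (RRec₁₃CoPHOn 𝔯 Rg) := by
  obtain ⟨r₀⟩ := Node00.nonempty_rateObjects₁₁ (N := N)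
  let lit : (F : T4Family) → (θ : Stage13HParams F N) → θ.Provisos₁₃CoPH F N → (ℕ → ℝ) → List (ULoop F) → Node00.RateObjects₁₁ N :=
    fun F _ _ _ _ => ⟨r₀.u3, r₀.ne3, fun _ => haveI := neZero_blockFactor F; c2Objects 3 F.hL b aS α β c35 p⟩
  let 𝔯 : RateReading₁₃CoPH N := ⟨lit, fun _ _ _ _ _ => (⟨Empty, ⟨fun q => q.elim, fun q => q.elim, fun q => q.elim⟩, 0⟩ : NE1pCarriers)⟩
  have h𝔯 : ∀ (F : T4Family) (θ : Stage13HParams F N) (hP : θ.Provisos₁₃CoPH F N) (g₀ : ℕ → ℝ) (os : List (ULoop F)) (k : ℕ),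
      (𝔯.lit F θ hP g₀ os).ne2 k = haveI := neZero_blockFactor F; c2Objects 3 F.hL b aS α β c35 p := fun _ _ _ _ _ _ => rfl
  have hS := s_N15_homes₁₃CoPH_of_forall_admissible 𝔯 fun F θ hP _ g₀ os k => by
    rw [h𝔯 F θ hP g₀ os k]
    exact n15At_c2Objects_family hb haS hc35 α β p F
  refine ⟨𝔯, h𝔯, fun F θ hP g₀ os k => ?_, hS.1, hS.2⟩
  rw [h𝔯 F θ hP g₀ os k]
  exact populated_c2Objects_family F b aS α β c35 p

variable (w1 : (F : T4Family) → (θ : Stage13HParams F N) → ReadingData F (Node00.MatA N) θ.τ9.M) (ℓ₃ : T4Family → NE3Letters₁₁)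
  (ne2 : (F : T4Family) → Stage13HParams F N → (ℕ → ℝ) → List (ULoop F) → ℕ → NE2Objects₁₁)
  (ne1 : (F : T4Family) → Stage13HParams F N → (ℕ → ℝ) → List (ULoop F) → NE1pCarriers)

/-- ★★ **THE PRIMITIVE-CARRIER RESIDUAL LAYER CLOSES `h15` AT BOTH HOMES OF THE READING OF RECORD, NO ESTIMATE DISPLAYED** — the shape dag-n27-c's
`spine_rec13CCoPH_at_readingAdm₁₃CoPH_of_…_family` leaves consume: if on the admissible Stage-13 tuples with provisos N15's residual layer `ne2` takes the primitive-carrier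
objects `c2Objects 3 F.hL b a_S α β c₃₅ p` as values, then `S_N15` at `RRec₁₃CoPH (readingOfRecord₁₃CoPH w1 ℓ₃ ne2 ne1)` AND at every `RRec₁₃CoPHOn (…) Rg` — the operator
layer with the background block LIVE over the primitive (3.35)–(3.36) letters (dag-n15-c FILE 11) and the two `U ≡ 1` kernel layers are theorems (§1), not hypotheses; plain
`b, a_S, c₃₅ > 0`. [bookkeeping] -/
theorem s_N15_readingOfRecord₁₃CoPH_homes_of_c2_family (hb : 0 < b) (haS : 0 < aS) {c35 : ℝ} (hc35 : 0 < c35) (α β : Fin 4) (p : ℝ)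
    (h : ∀ (F : T4Family) (θ : Stage13HParams F N), θ.Provisos₁₃CoPH F N → θ.Admissible F N → ∀ (g₀ : ℕ → ℝ) (os : List (ULoop F)) (k : ℕ),
      ne2 F θ g₀ os k = haveI := neZero_blockFactor F; c2Objects 3 F.hL b aS α β c35 p) :
    S_N15 (RRec₁₃CoPH (readingOfRecord₁₃CoPH w1 ℓ₃ ne2 ne1)) ∧
      ∀ Rg : (F : T4Family) → Stage13HParams F N → Prop, S_N15 (RRec₁₃CoPHOn (readingOfRecord₁₃CoPH w1 ℓ₃ ne2 ne1) Rg) :=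
  s_N15_readingOfRecord₁₃CoPH_homes_of_forall w1 ℓ₃ ne2 ne1 fun F θ hP hA g₀ os k => by
    rw [h F θ hP hA g₀ os k]
    exact n15At_c2Objects_family hb haS hc35 α β p F

/-- … at the canonical home alone. [bookkeeping] -/
theorem s_N15_readingOfRecord₁₃CoPH_of_c2_family (hb : 0 < b) (haS : 0 < aS) {c35 : ℝ} (hc35 : 0 < c35) (α β : Fin 4) (p : ℝ)
    (h : ∀ (F : T4Family) (θ : Stage13HParams F N), θ.Provisos₁₃CoPH F N → θ.Admissible F N → ∀ (g₀ : ℕ → ℝ) (os : List (ULoop F)) (k : ℕ),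
      ne2 F θ g₀ os k = haveI := neZero_blockFactor F; c2Objects 3 F.hL b aS α β c35 p) :
    S_N15 (RRec₁₃CoPH (readingOfRecord₁₃CoPH w1 ℓ₃ ne2 ne1)) :=
  (s_N15_readingOfRecord₁₃CoPH_homes_of_c2_family w1 ℓ₃ ne2 ne1 hb haS hc35 α β p h).1

/-- … at the `Rg`-guarded home (every `Rg`). [bookkeeping] -/
theorem s_N15_readingOfRecord₁₃CoPHOn_of_c2_family (hb : 0 < b) (haS : 0 < aS) {c35 : ℝ} (hc35 : 0 < c35) (α β : Fin 4) (p : ℝ)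
    (h : ∀ (F : T4Family) (θ : Stage13HParams F N), θ.Provisos₁₃CoPH F N → θ.Admissible F N → ∀ (g₀ : ℕ → ℝ) (os : List (ULoop F)) (k : ℕ),
      ne2 F θ g₀ os k = haveI := neZero_blockFactor F; c2Objects 3 F.hL b aS α β c35 p)
    (Rg : (F : T4Family) → Stage13HParams F N → Prop) : S_N15 (RRec₁₃CoPHOn (readingOfRecord₁₃CoPH w1 ℓ₃ ne2 ne1) Rg) :=
  (s_N15_readingOfRecord₁₃CoPH_homes_of_c2_family w1 ℓ₃ ne2 ne1 hb haS hc35 α β p h).2 Rg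

/-- … such a reading of record is `Populated` at every Stage-13 tuple with provisos (§3 `populated_c2Objects_family`). [bookkeeping] -/
theorem populated_readingOfRecord₁₃CoPH_of_c2_family (α β : Fin 4) (c35 p : ℝ) (F : T4Family) (θ : Stage13HParams F N)
    (hP : θ.Provisos₁₃CoPH F N) (g₀ : ℕ → ℝ) (os : List (ULoop F))
    (h : ∀ k : ℕ, ne2 F θ g₀ os k = haveI := neZero_blockFactor F; c2Objects 3 F.hL b aS α β c35 p) :
    ((readingOfRecord₁₃CoPH w1 ℓ₃ ne2 ne1).lit F θ hP g₀ os).Populated := by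
  refine (readingOfRecord₁₃CoPH_populated_iff w1 ℓ₃ ne2 ne1 F θ hP g₀ os).2 fun k => ?_
  rw [h k]
  exact populated_c2Objects_family F b aS α β c35 p

/-! NOTE.  The pure-existence face «SOME residual layer closes `h15` at both homes, populated everywhere» (part 80's `exists_ne2_s_N15_readingOfRecord₁₃CoPH_byParts`)
has a statement that does not mention the witnessing family; the primitive-carrier family is ANOTHER witness of that SAME landed statement (by the theorems above) — it is
cited, not re-filed (gate `dedup.landed`). -/

end C2

end Summit.QuantumFields.YangMills.BalabanUVNodes.N15.AtReadingOfRecord13CoPH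

end
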